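import Mathlib.Analysis.FunctionalSpaces.SobolevInequality
import Mathlib.Analysis.InnerProductSpace.PiL2
import Mathlib.Analysis.SpecialFunctions.Pow.Integral
import HarnessLib

/-!
# A cutoff Gagliardo–Nirenberg interpolation inequality: `∫_S f² |Φ|` against `‖Φ‖_{L²}`

Analysis/FluidPDE support file; second file of the discharge of the named fact
`Literature.Analysis.FluidPDE.tao2011_nonlinearEstimate` (`TaoNonlinearEstimate.lean`, the
estimate for the nonlinear term `Y₆` in the proof of Tao 2011, Thm. 10.1, arXiv:1108.1165
pp. 32–33). The step of the printed proof served here is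
"From Hölder's inequality we thus have `Y₆,₁ ≲ … Σᵢ rᵢ^{3/2}‖ω‖²_{L⁶(Bᵢ)}‖ω‖_{L²(2Bᵢ)}`" together with
"from the Sobolev inequality one has
`‖ω‖_{L⁶(Bᵢ)} ≲ ‖ωψᵢ‖_{L⁶} ≲ ‖∇(ωψᵢ)‖_{L²} ≲ ‖∇ω‖_{L²(3Bᵢ)} + rᵢ⁻¹‖ω‖_{L²(3Bᵢ)}`" (p. 32), in a
form with the scale parameter made explicit and the fractional powers linearised by the
arithmetic–geometric mean inequality (so that the estimate can be summed over regions):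

* `integral_pow_six_le_of_gns` — the Gagliardo–Nirenberg–Sobolev inequality `Ḣ¹(ℝ³) ⊂ L⁶` for
  real `C¹_c` functions in integral form, `∫ g⁶ ≤ C⁶ (∫ ‖Dg‖²)³` (Mathlib's
  `MeasureTheory.eLpNorm_le_eLpNorm_fderiv_of_eq_inner`, `n = 3`, `p = 2`, `p* = 6`);
* `integral_pow_four_le` — the interpolation `∫ g⁴ ≤ (∫ g²)^{1/2} (∫ g⁶)^{1/2}` (Cauchy–Schwarz);
* `integral_sq_mul_abs_le` — `∫ g² |Φ| ≤ (∫ g⁴)^{1/2} (∫ Φ²)^{1/2}` (Cauchy–Schwarz);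
* `integral_norm_fderiv_mul_sq_le` — for a `C¹` cutoff `ψ` with `|ψ| ≤ 1`, `‖Dψ‖ ≤ L`:
  `∫ ‖D(ψ f)‖² ≤ 2 ∫_{tsupport ψ} (‖Df‖² + L² f²)`;
* `setIntegral_sq_mul_abs_le_of_cutoff` — **the packaged estimate**: there is an absolute
  constant `C₀` such that for `f ∈ C¹(ℝ³)`, a `C¹_c` cutoff `ψ` (`0 ≤ ψ ≤ 1`, `‖Dψ‖ ≤ L`, `ψ = 1`
  on `S`), `Φ ∈ L²`, and every `σ > 0`,
  `∫_S f² |Φ| ≤ C₀ ‖Φ‖_{L²} (σ⁻³ ∫_{tsupport ψ} f² + σ ∫_{tsupport ψ} (‖Df‖² + L² f²))`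
  — i.e. `‖f‖²_{L⁴(S)} ‖Φ‖_{L²}` bounded via `‖g‖₄² ≤ ‖g‖₂^{1/2}‖g‖₆^{3/2} ≤ C^{3/2}‖g‖₂^{1/2}‖Dg‖₂^{3/2}`
  (`g = ψ f`) and `a^{1/4} b^{3/4} ≤ ¼ σ⁻³ a + ¾ σ b`, the last step done with square roots only
  (`sqrt_mul_mul_le_sq`).

## Mathlib / tree search

Mathlib: `MeasureTheory.eLpNorm_le_eLpNorm_fderiv_of_eq_inner` and its constant
`MeasureTheory.eLpNormLESNormFDerivOfEqInnerConst` (`Analysis/FunctionalSpaces/SobolevInequality`),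
`MeasureTheory.integral_mul_norm_le_Lp_mul_Lq`, `MeasureTheory.MemLp.eLpNorm_eq_integral_rpow_norm`,
`support_fderiv_subset`. Tree: `Literature.Analysis.FunctionSpaces.eLpNorm_le_mul_eLpNorm_fderiv_of_eq`
(GNS for general normed targets) — not needed for real `f`; `lean search 'pow_four_le|L4.*interp'`:
no prior `L⁴` interpolation in integral form.

## References

* T. Tao, *Localisation and compactness properties of the Navier–Stokes global regularity
  problem*, Anal. PDE 6 (2013) 25–107 = arXiv:1108.1165 (`Tao2011`), §10, proof of Thm. 10.1,
  p. 32 (Hölder and Sobolev steps for `Y₆,₁`).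
* L. C. Evans, *Partial Differential Equations*, 2nd ed. (2010), §5.6.1 Thm. 1
  (Gagliardo–Nirenberg–Sobolev inequality).
-/

noncomputable section

open MeasureTheory Set Filter Topology Function
open scoped ENNReal NNReal

namespace Literature.Analysis.FluidPDE

/-- Local notation for physical space `ℝ³ = EuclideanSpace ℝ (Fin 3)`. -/
local notation "ℝ³" => EuclideanSpace ℝ (Fin 3)

/-! ### The Gagliardo–Nirenberg–Sobolev inequality `Ḣ¹ ⊂ L⁶` in integral form -/

/-- `‖g‖^6 = g^6` pointwise bookkeeping. [folklore] -/
theorem norm_rpow_six_eq (t : ℝ) : ‖t‖ ^ (6 : ℝ) = t ^ 6 := by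
  rw [Real.norm_eq_abs, show (6 : ℝ) = ((6 : ℕ) : ℝ) by norm_num, Real.rpow_natCast,
    Even.pow_abs ⟨3, rfl⟩]

/-- `‖t‖^2 = t^2` pointwise bookkeeping. [folklore] -/
theorem norm_rpow_two_eq' (t : ℝ) : ‖t‖ ^ (2 : ℝ) = t ^ 2 := by
  rw [Real.norm_eq_abs, Real.rpow_two, sq_abs]

/-- **GNS in integral form:** for a real `C¹_c` function `g` on `ℝ³`,
`∫ g⁶ ≤ C⁶ (∫ ‖Dg‖²)³`, `C` Mathlib's Gagliardo–Nirenberg–Sobolev constant for `p = 2`, `n = 3`.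
[folklore] -/
theorem integral_pow_six_le_of_gns {g : ℝ³ → ℝ} (hg : ContDiff ℝ 1 g) (hgc : HasCompactSupport g) :
    ∫ x, g x ^ 6 ≤
      ((eLpNormLESNormFDerivOfEqInnerConst (volume : Measure ℝ³) 2 : ℝ≥0) : ℝ) ^ 6 *
        (∫ x, ‖fderiv ℝ g x‖ ^ 2) ^ 3 := by
  set C : ℝ≥0 := eLpNormLESNormFDerivOfEqInnerConst (volume : Measure ℝ³) 2 with hC
  have hgm : MemLp g ((6 : ℝ≥0) : ℝ≥0∞) volume := hg.continuous.memLp_of_hasCompactSupport hgc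
  have hDc : Continuous (fderiv ℝ g) := hg.continuous_fderiv one_ne_zero
  have hDm : MemLp (fderiv ℝ g) ((2 : ℝ≥0) : ℝ≥0∞) volume :=
    hDc.memLp_of_hasCompactSupport (hgc.fderiv ℝ)
  have h := eLpNorm_le_eLpNorm_fderiv_of_eq_inner (μ := (volume : Measure ℝ³)) hg hgc
    (p := 2) (p' := 6) (by norm_num) (by rw [finrank_euclideanSpace_fin]; norm_num)
    (by rw [finrank_euclideanSpace_fin]; norm_num)
  have hC' : eLpNormLESNormFDerivOfEqInnerConst (volume : Measure ℝ³) ((2 : ℝ≥0) : ℝ) = C := by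
    rw [hC, NNReal.coe_ofNat]
  rw [hC'] at h
  rw [hgm.eLpNorm_eq_integral_rpow_norm (by norm_num) ENNReal.coe_ne_top,
    hDm.eLpNorm_eq_integral_rpow_norm (by norm_num) ENNReal.coe_ne_top] at h
  simp only [ENNReal.coe_ofNat, ENNReal.toReal_ofNat] at h
  set I₆ := ∫ x, ‖g x‖ ^ (6 : ℝ) with hI₆
  set I₂ := ∫ x, ‖fderiv ℝ g x‖ ^ (2 : ℝ) with hI₂
  have hI₆0 : 0 ≤ I₆ := integral_nonneg fun x => by positivity
  have hI₂0 : 0 ≤ I₂ := integral_nonneg fun x => by positivity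
  rw [← ENNReal.ofReal_coe_nnreal, ← ENNReal.ofReal_mul (NNReal.coe_nonneg C),
    ENNReal.ofReal_le_ofReal_iff (mul_nonneg (NNReal.coe_nonneg C) (Real.rpow_nonneg hI₂0 _))] at h
  -- raise to the sixth power
  have h6 := pow_le_pow_left₀ (Real.rpow_nonneg hI₆0 _) h 6
  have e1 : (I₆ ^ (6 : ℝ)⁻¹) ^ (6 : ℕ) = I₆ := by
    rw [← Real.rpow_natCast, ← Real.rpow_mul hI₆0]; norm_num
  have e2 : (I₂ ^ (2 : ℝ)⁻¹) ^ (6 : ℕ) = I₂ ^ 3 := by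
    rw [← Real.rpow_natCast, ← Real.rpow_mul hI₂0]
    norm_num
  rw [e1, mul_pow, e2] at h6
  have hI₆' : ∫ x, g x ^ 6 = I₆ := integral_congr_ae (Eventually.of_forall fun x => (norm_rpow_six_eq _).symm)
  have hI₂' : ∫ x, ‖fderiv ℝ g x‖ ^ 2 = I₂ :=
    integral_congr_ae (Eventually.of_forall fun x => (Real.rpow_two _).symm)
  rw [hI₆', hI₂']
  exact h6

/-! ### Two Cauchy–Schwarz steps -/

/-- **`L⁴` interpolation:** `∫ g⁴ ≤ (∫ g²)^{1/2} (∫ g⁶)^{1/2}` for `g ∈ L² ∩ L⁶` (here: continuous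
with compact support). [folklore] -/
theorem integral_pow_four_le {g : ℝ³ → ℝ} (hg : Continuous g) (hgc : HasCompactSupport g) :
    ∫ x, g x ^ 4 ≤ Real.sqrt (∫ x, g x ^ 2) * Real.sqrt (∫ x, g x ^ 6) := by
  have h2 : MemLp g (ENNReal.ofReal 2) volume := hg.memLp_of_hasCompactSupport hgc
  have h3c : HasCompactSupport (fun x => g x ^ 3) :=
    hgc.comp_left (g := fun t : ℝ => t ^ 3) (zero_pow three_ne_zero)
  have h3cont : Continuous (fun x => g x ^ 3) := hg.pow 3
  have h3 : MemLp (fun x => g x ^ 3) (ENNReal.ofReal 2) volume :=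
    h3cont.memLp_of_hasCompactSupport h3c
  have h := integral_mul_norm_le_Lp_mul_Lq Real.HolderConjugate.two_two h2 h3
  have e1 : ∫ x, ‖g x‖ * ‖g x ^ 3‖ = ∫ x, g x ^ 4 := integral_congr_ae
    (Eventually.of_forall fun x => by
      simp only [Real.norm_eq_abs, abs_pow, ← pow_succ', Even.pow_abs ⟨2, rfl⟩])
  have e2 : ∫ x, ‖g x‖ ^ (2 : ℝ) = ∫ x, g x ^ 2 :=
    integral_congr_ae (Eventually.of_forall fun x => norm_rpow_two_eq' _)
  have e3 : ∫ x, ‖g x ^ 3‖ ^ (2 : ℝ) = ∫ x, g x ^ 6 := integral_congr_ae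
    (Eventually.of_forall fun x => by
      show ‖g x ^ 3‖ ^ (2 : ℝ) = g x ^ 6
      rw [norm_rpow_two_eq', ← pow_mul])
  rw [e1, e2, e3, ← Real.sqrt_eq_rpow, ← Real.sqrt_eq_rpow] at h
  exact h

/-- **Pairing with an `L²` function:** `∫ g² |Φ| ≤ (∫ g⁴)^{1/2} (∫ Φ²)^{1/2}`. [folklore] -/
theorem integral_sq_mul_abs_le {g Φ : ℝ³ → ℝ} (hg : Continuous g) (hgc : HasCompactSupport g)
    (hΦ : MemLp Φ 2 volume) :
    ∫ x, g x ^ 2 * |Φ x| ≤ Real.sqrt (∫ x, g x ^ 4) * Real.sqrt (∫ x, Φ x ^ 2) := by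
  have h2c : HasCompactSupport (fun x => g x ^ 2) :=
    hgc.comp_left (g := fun t : ℝ => t ^ 2) (zero_pow two_ne_zero)
  have h2cont : Continuous (fun x => g x ^ 2) := hg.pow 2
  have h2 : MemLp (fun x => g x ^ 2) (ENNReal.ofReal 2) volume :=
    h2cont.memLp_of_hasCompactSupport h2c
  have hΦ' : MemLp Φ (ENNReal.ofReal 2) volume := by rwa [ENNReal.ofReal_ofNat]
  have h := integral_mul_norm_le_Lp_mul_Lq Real.HolderConjugate.two_two h2 hΦ'
  have e1 : ∫ x, ‖g x ^ 2‖ * ‖Φ x‖ = ∫ x, g x ^ 2 * |Φ x| := integral_congr_ae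
    (Eventually.of_forall fun x => by simp only [Real.norm_eq_abs, abs_pow, sq_abs])
  have e2 : ∫ x, ‖g x ^ 2‖ ^ (2 : ℝ) = ∫ x, g x ^ 4 := integral_congr_ae
    (Eventually.of_forall fun x => by
      show ‖g x ^ 2‖ ^ (2 : ℝ) = g x ^ 4
      rw [norm_rpow_two_eq', ← pow_mul])
  have e3 : ∫ x, ‖Φ x‖ ^ (2 : ℝ) = ∫ x, Φ x ^ 2 :=
    integral_congr_ae (Eventually.of_forall fun x => norm_rpow_two_eq' _)
  rw [e1, e2, e3, ← Real.sqrt_eq_rpow, ← Real.sqrt_eq_rpow] at h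
  exact h

/-! ### The gradient of a cut-off function -/

/-- **`∫ ‖D(ψ f)‖² ≤ 2 ∫_{tsupport ψ} (‖Df‖² + L² f²)`** for `f ∈ C¹`, `ψ ∈ C¹_c` with `|ψ| ≤ 1`
and `‖Dψ‖ ≤ L` (Leibniz rule; off `tsupport ψ` the product vanishes identically). [folklore] -/
theorem integral_norm_fderiv_mul_sq_le {f ψ : ℝ³ → ℝ} (hf : ContDiff ℝ 1 f) (hψ : ContDiff ℝ 1 ψ)
    (hψc : HasCompactSupport ψ) (hψ1 : ∀ x, |ψ x| ≤ 1) {L : ℝ} (hL : ∀ x, ‖fderiv ℝ ψ x‖ ≤ L) :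
    ∫ x, ‖fderiv ℝ (fun y => ψ y * f y) x‖ ^ 2 ≤
      2 * ∫ x in tsupport ψ, (‖fderiv ℝ f x‖ ^ 2 + L ^ 2 * f x ^ 2) := by
  have hL0 : 0 ≤ L := (norm_nonneg _).trans (hL 0)
  have hK : IsCompact (tsupport ψ) := hψc
  -- pointwise Leibniz bound
  have hpt : ∀ x, ‖fderiv ℝ (fun y => ψ y * f y) x‖ ^ 2 ≤
      (tsupport ψ).indicator (fun x => 2 * (‖fderiv ℝ f x‖ ^ 2 + L ^ 2 * f x ^ 2)) x := by
    intro x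
    by_cases hx : x ∈ tsupport ψ
    · rw [indicator_of_mem hx]
      rw [fderiv_fun_mul (hψ.differentiable one_ne_zero x) (hf.differentiable one_ne_zero x)]
      have h1 : ‖ψ x • fderiv ℝ f x + f x • fderiv ℝ ψ x‖ ≤ ‖fderiv ℝ f x‖ + L * |f x| := by
        refine (norm_add_le _ _).trans (add_le_add ?_ ?_)
        · rw [norm_smul, Real.norm_eq_abs]
          exact (mul_le_mul_of_nonneg_right (hψ1 x) (norm_nonneg _)).trans (by rw [one_mul])
        · rw [norm_smul, Real.norm_eq_abs, mul_comm]
          exact mul_le_mul_of_nonneg_right (hL x) (abs_nonneg _)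
      have h2 : (‖fderiv ℝ f x‖ + L * |f x|) ^ 2 ≤ 2 * (‖fderiv ℝ f x‖ ^ 2 + L ^ 2 * f x ^ 2) := by
        nlinarith [sq_nonneg (‖fderiv ℝ f x‖ - L * |f x|), sq_abs (f x)]
      exact (pow_le_pow_left₀ (norm_nonneg _) h1 2).trans h2
    · rw [indicator_of_notMem hx]
      have : fderiv ℝ (fun y => ψ y * f y) x = 0 := by
        rw [← notMem_support]
        refine fun h => hx ?_
        have hsub : support (fderiv ℝ (fun y => ψ y * f y)) ⊆ tsupport (fun y => ψ y * f y) :=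
          support_fderiv_subset ℝ
        exact (tsupport_mul_subset_left (hsub h))
      rw [this, norm_zero]
      simp
  have hcont : Continuous fun x => 2 * (‖fderiv ℝ f x‖ ^ 2 + L ^ 2 * f x ^ 2) := by
    have := hf.continuous_fderiv one_ne_zero
    fun_prop
  have hint : Integrable ((tsupport ψ).indicator fun x => 2 * (‖fderiv ℝ f x‖ ^ 2 + L ^ 2 * f x ^ 2))
      volume :=
    (hcont.continuousOn.integrableOn_compact hK).integrable_indicator hK.measurableSet
  calc ∫ x, ‖fderiv ℝ (fun y => ψ y * f y) x‖ ^ 2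
      ≤ ∫ x, (tsupport ψ).indicator (fun x => 2 * (‖fderiv ℝ f x‖ ^ 2 + L ^ 2 * f x ^ 2)) x :=
        integral_mono_of_nonneg (Eventually.of_forall fun x => by positivity) hint
          (Eventually.of_forall hpt)
    _ = 2 * ∫ x in tsupport ψ, (‖fderiv ℝ f x‖ ^ 2 + L ^ 2 * f x ^ 2) := by
        rw [integral_indicator hK.measurableSet, integral_const_mul]

/-! ### The arithmetic–geometric step with square roots -/

/-- **`√(pq)·q ≤ (p/4 + 3q/4)²`** for `p, q ≥ 0` — the square of the weighted
arithmetic–geometric mean inequality `p^{1/4} q^{3/4} ≤ ¼p + ¾q`, proved polynomially via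
`16t ≤ (t² + 3)²`, `(t² + 3)² - 16t = (t - 1)²(t² + 2t + 9)`. [folklore] -/
theorem sqrt_mul_mul_le_sq {p q : ℝ} (hp : 0 ≤ p) (hq : 0 ≤ q) :
    Real.sqrt (p * q) * q ≤ (p / 4 + 3 * q / 4) ^ 2 := by
  set s := Real.sqrt (p * q) with hs
  have hs0 : 0 ≤ s := Real.sqrt_nonneg _
  have hs2 : s ^ 2 = p * q := Real.sq_sqrt (mul_nonneg hp hq)
  -- `q² ((p + 3q)² - 16 s q) = (s - q)² (pq + 2sq + 9q²) ≥ 0`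
  have key : 0 ≤ q ^ 2 * ((p + 3 * q) ^ 2 - 16 * s * q) := by
    have hid : q ^ 2 * ((p + 3 * q) ^ 2 - 16 * s * q) =
        (s - q) ^ 2 * (p * q + 2 * s * q + 9 * q ^ 2) := by
      linear_combination (-2 * q * s - (p * q + 5 * q ^ 2)) * hs2
    rw [hid]
    positivity
  have hsq : (p / 4 + 3 * q / 4) ^ 2 = ((p + 3 * q) ^ 2) / 16 := by ring
  rcases eq_or_lt_of_le hq with hq0 | hq0
  · rw [← hq0]
    simp only [mul_zero, zero_div, add_zero]
    positivity
  · have hq2 : 0 < q ^ 2 := by positivity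
    have h1 : 0 ≤ (p + 3 * q) ^ 2 - 16 * s * q := (mul_nonneg_iff_of_pos_left hq2).1 key
    rw [hsq]
    have h2 : s * q ≤ (p + 3 * q) ^ 2 / 16 := by linarith
    exact h2

/-! ### The packaged estimate -/

/-- **The cutoff interpolation estimate, linearised.** For `f ∈ C¹(ℝ³)`, a cutoff
`ψ ∈ C¹_c(ℝ³)` with `0 ≤ ψ ≤ 1`, `‖Dψ‖ ≤ L` and `ψ = 1` on the measurable set `S`, a function
`Φ ∈ L²(ℝ³)`, and every `σ > 0`:
`∫_S f² |Φ| ≤ C^{3/2} ‖Φ‖_{L²} (¼ σ⁻³ ∫_T f² + (3/2) σ ∫_T (‖Df‖² + L² f²))`, `T = tsupport ψ`,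
`C` the Gagliardo–Nirenberg–Sobolev constant — Tao's
`∫_{Bᵢ}|ω|²Fᵢ ≲ rᵢ^{1/2}‖ω‖²_{L⁶(Bᵢ)}‖Fᵢ‖_{L²}`, `‖ω‖_{L⁶(Bᵢ)} ≲ ‖∇ω‖_{L²(3Bᵢ)} + rᵢ⁻¹‖ω‖_{L²(3Bᵢ)}`
(p. 32) with `Bᵢ, 3Bᵢ` replaced by `S ⊆ {ψ = 1}`, `tsupport ψ`, the Hölder step done as
`‖f‖²_{L⁴(S)} ≤ ‖g‖₂^{1/2}‖g‖₆^{3/2}` (`g = ψf`) and the powers linearised by `a^{1/4}b^{3/4} ≤ ¼σ⁻³a + ¾σb`.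
[cite: Tao2011, §10, proof of Thm. 10.1 (p. 32, Hölder and Sobolev steps)] -/
theorem setIntegral_sq_mul_abs_le_of_cutoff {f ψ Φ : ℝ³ → ℝ} (hf : ContDiff ℝ 1 f)
    (hψ : ContDiff ℝ 1 ψ) (hψc : HasCompactSupport ψ) (hψ01 : ∀ x, 0 ≤ ψ x ∧ ψ x ≤ 1)
    {L : ℝ} (hL : ∀ x, ‖fderiv ℝ ψ x‖ ≤ L) {S : Set ℝ³} (hS : MeasurableSet S)
    (hψS : ∀ x ∈ S, ψ x = 1) (hΦ : MemLp Φ 2 volume) {σ : ℝ} (hσ : 0 < σ) :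
    ∫ x in S, f x ^ 2 * |Φ x| ≤
      ((eLpNormLESNormFDerivOfEqInnerConst (volume : Measure ℝ³) 2 : ℝ≥0) : ℝ) *
        Real.sqrt ((eLpNormLESNormFDerivOfEqInnerConst (volume : Measure ℝ³) 2 : ℝ≥0) : ℝ) *
        Real.sqrt (∫ x, Φ x ^ 2) *
        (σ⁻¹ ^ 3 * (∫ x in tsupport ψ, f x ^ 2) / 4 +
          3 * (σ * (2 * ∫ x in tsupport ψ, (‖fderiv ℝ f x‖ ^ 2 + L ^ 2 * f x ^ 2))) / 4) := by
  set C : ℝ := ((eLpNormLESNormFDerivOfEqInnerConst (volume : Measure ℝ³) 2 : ℝ≥0) : ℝ) with hC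
  have hC0 : 0 ≤ C := NNReal.coe_nonneg _
  have hK : IsCompact (tsupport ψ) := hψc
  -- the cut-off function `g = ψ f`
  set g : ℝ³ → ℝ := fun y => ψ y * f y with hg
  have hg1 : ContDiff ℝ 1 g := hψ.mul hf
  have hgc : HasCompactSupport g := hψc.mul_right
  have hgcont : Continuous g := hg1.continuous
  -- Step 1: `∫_S f²|Φ| ≤ ∫ g²|Φ|`
  have hgΦ : Integrable (fun x => g x ^ 2 * |Φ x|) volume := by
    have h2c : HasCompactSupport (fun x => g x ^ 2) :=
      hgc.comp_left (g := fun t : ℝ => t ^ 2) (zero_pow two_ne_zero)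
    have h2cont : Continuous (fun x => g x ^ 2) := hgcont.pow 2
    have h2 : MemLp (fun x => g x ^ 2) 2 volume := h2cont.memLp_of_hasCompactSupport h2c
    have := h2.integrable_mul hΦ
    refine (this.norm).congr (Eventually.of_forall fun x => ?_)
    simp only [Pi.mul_apply, norm_mul, Real.norm_eq_abs, abs_pow, sq_abs]
  have step1 : ∫ x in S, f x ^ 2 * |Φ x| ≤ ∫ x, g x ^ 2 * |Φ x| := by
    have heq : ∫ x in S, f x ^ 2 * |Φ x| = ∫ x in S, g x ^ 2 * |Φ x| :=
      setIntegral_congr_fun hS fun x hx => by simp only [hg, hψS x hx, one_mul]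
    rw [heq]
    exact setIntegral_le_integral hgΦ (Eventually.of_forall fun x => by positivity)
  -- Step 2: the two Cauchy–Schwarz steps and GNS
  have step2 := integral_sq_mul_abs_le hgcont hgc hΦ
  have step3 := integral_pow_four_le hgcont hgc
  have step4 := integral_pow_six_le_of_gns hg1 hgc
  rw [← hC] at step4
  -- the two basic quantities `a = ∫ g²`, `b = ∫ ‖Dg‖²`
  set a := ∫ x, g x ^ 2 with ha
  set b := ∫ x, ‖fderiv ℝ g x‖ ^ 2 with hb
  have ha0 : 0 ≤ a := integral_nonneg fun x => sq_nonneg _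
  have hb0 : 0 ≤ b := integral_nonneg fun x => sq_nonneg _
  have h4_0 : 0 ≤ ∫ x, g x ^ 4 := integral_nonneg fun x => by positivity
  -- `√(∫ g⁶) ≤ C³ b √b`
  have h6 : Real.sqrt (∫ x, g x ^ 6) ≤ C ^ 3 * b * Real.sqrt b := by
    calc Real.sqrt (∫ x, g x ^ 6) ≤ Real.sqrt (C ^ 6 * b ^ 3) := Real.sqrt_le_sqrt step4
      _ = C ^ 3 * b * Real.sqrt b := by
        rw [show C ^ 6 * b ^ 3 = (C ^ 3 * b) ^ 2 * b by ring, Real.sqrt_mul (sq_nonneg _),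
          Real.sqrt_sq (by positivity)]
  -- `∫ g⁴ ≤ C³ √(ab) b`
  have h4 : ∫ x, g x ^ 4 ≤ C ^ 3 * (Real.sqrt (a * b) * b) := by
    calc ∫ x, g x ^ 4 ≤ Real.sqrt a * Real.sqrt (∫ x, g x ^ 6) := step3
      _ ≤ Real.sqrt a * (C ^ 3 * b * Real.sqrt b) :=
          mul_le_mul_of_nonneg_left h6 (Real.sqrt_nonneg _)
      _ = C ^ 3 * (Real.sqrt (a * b) * b) := by rw [Real.sqrt_mul ha0]; ring
  -- bounds for `a` and `b` in terms of `f` on `T = tsupport ψ`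
  have hψabs : ∀ x, |ψ x| ≤ 1 := fun x => abs_le.2 ⟨by linarith [(hψ01 x).1], (hψ01 x).2⟩
  have hbT : b ≤ 2 * ∫ x in tsupport ψ, (‖fderiv ℝ f x‖ ^ 2 + L ^ 2 * f x ^ 2) :=
    integral_norm_fderiv_mul_sq_le hf hψ hψc hψabs hL
  have haT : a ≤ ∫ x in tsupport ψ, f x ^ 2 := by
    have hint : Integrable ((tsupport ψ).indicator fun x => f x ^ 2) volume :=
      ((hf.continuous.pow 2).continuousOn.integrableOn_compact hK).integrable_indicator
        hK.measurableSet
    calc a = ∫ x, g x ^ 2 := rfl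
      _ ≤ ∫ x, (tsupport ψ).indicator (fun x => f x ^ 2) x := by
          refine integral_mono_of_nonneg (Eventually.of_forall fun x => sq_nonneg _) hint
            (Eventually.of_forall fun x => ?_)
          by_cases hx : x ∈ tsupport ψ
          · rw [indicator_of_mem hx, hg]
            simp only
            rw [mul_pow]
            have : ψ x ^ 2 ≤ 1 := by nlinarith [(hψ01 x).1, (hψ01 x).2]
            nlinarith [sq_nonneg (f x)]
          · rw [indicator_of_notMem hx, hg]
            simp only
            rw [image_eq_zero_of_notMem_tsupport hx, zero_mul]
            simp
      _ = ∫ x in tsupport ψ, f x ^ 2 := integral_indicator hK.measurableSet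
  -- the scaled quantities `p = σ⁻³ a'`, `q = σ b'` with `a' ≥ a`, `b' ≥ b`
  set a' := ∫ x in tsupport ψ, f x ^ 2 with ha'
  set b' := 2 * ∫ x in tsupport ψ, (‖fderiv ℝ f x‖ ^ 2 + L ^ 2 * f x ^ 2) with hb'
  have ha'0 : 0 ≤ a' := ha0.trans haT
  have hb'0 : 0 ≤ b' := hb0.trans hbT
  -- `√(ab) b ≤ √(a'b') b' = √(pq) q ≤ (p/4 + 3q/4)²` with `p = σ⁻³a'`, `q = σ b'`
  have hmono : Real.sqrt (a * b) * b ≤ Real.sqrt (a' * b') * b' :=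
    mul_le_mul (Real.sqrt_le_sqrt (mul_le_mul haT hbT hb0 ha'0)) hbT hb0 (Real.sqrt_nonneg _)
  have hpq : Real.sqrt (a' * b') * b' = Real.sqrt ((σ⁻¹ ^ 3 * a') * (σ * b')) * (σ * b') := by
    have hσ3 : σ⁻¹ ^ 3 * a' * (σ * b') = σ⁻¹ ^ 2 * (a' * b') := by
      field_simp
    have hsq : Real.sqrt (σ⁻¹ ^ 2 * (a' * b')) = σ⁻¹ * Real.sqrt (a' * b') :=
      (Real.sqrt_mul (by positivity : (0 : ℝ) ≤ σ⁻¹ ^ 2) (a' * b')).trans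
        (by rw [Real.sqrt_sq (by positivity)])
    rw [hσ3, hsq]
    field_simp
  have hAG := sqrt_mul_mul_le_sq (p := σ⁻¹ ^ 3 * a') (q := σ * b') (by positivity) (by positivity)
  set Q := σ⁻¹ ^ 3 * a' / 4 + 3 * (σ * b') / 4 with hQ
  have hQ0 : 0 ≤ Q := by positivity
  have hkey : Real.sqrt (a * b) * b ≤ Q ^ 2 := by
    calc Real.sqrt (a * b) * b ≤ Real.sqrt (a' * b') * b' := hmono
      _ = Real.sqrt ((σ⁻¹ ^ 3 * a') * (σ * b')) * (σ * b') := hpq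
      _ ≤ Q ^ 2 := hAG
  have h4' : ∫ x, g x ^ 4 ≤ (C * Real.sqrt C * Q) ^ 2 := by
    calc ∫ x, g x ^ 4 ≤ C ^ 3 * (Real.sqrt (a * b) * b) := h4
      _ ≤ C ^ 3 * Q ^ 2 := mul_le_mul_of_nonneg_left hkey (by positivity)
      _ = (C * Real.sqrt C * Q) ^ 2 := by
          rw [mul_pow, mul_pow, Real.sq_sqrt hC0]; ring
  have hsqrt4 : Real.sqrt (∫ x, g x ^ 4) ≤ C * Real.sqrt C * Q := by
    rw [← Real.sqrt_sq (show 0 ≤ C * Real.sqrt C * Q by positivity)]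
    exact Real.sqrt_le_sqrt h4'
  -- assemble
  have hΦ0 : 0 ≤ Real.sqrt (∫ x, Φ x ^ 2) := Real.sqrt_nonneg _
  calc ∫ x in S, f x ^ 2 * |Φ x| ≤ ∫ x, g x ^ 2 * |Φ x| := step1
    _ ≤ Real.sqrt (∫ x, g x ^ 4) * Real.sqrt (∫ x, Φ x ^ 2) := step2
    _ ≤ (C * Real.sqrt C * Q) * Real.sqrt (∫ x, Φ x ^ 2) :=
        mul_le_mul_of_nonneg_right hsqrt4 hΦ0
    _ = C * Real.sqrt C * Real.sqrt (∫ x, Φ x ^ 2) * Q := by ring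

end Literature.Analysis.FluidPDE

end
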